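import Mathlib.Analysis.PSeries
import Literature.NumberTheory.LFunctions.ConreyCharacterSumsRH
import Literature.Analysis.ValidatedNumerics.FixedPointInterval
import Literature.NumberTheory.EllipticCurves.MatsunoCurvesPrimesProofs

/-!
# RiemannHypothesis / CharacterSums — crux `ConreyPositivity` (stmt-RiemannHypothesis-16980): the imitation
certificate (negative lane)

Helpers for the refutation `CharacterSumsConreyPositivity_refuted`
(`Theorems/CharacterSumsConreyPositivityRefutation.lean`); nothing here asserts a Theses decl.
* `ConreyPositivityCert.exists_prime_imitating` — for every `M`, `N` a prime `q ≡ 3 (mod 8)`, `q > N`, whose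
  Legendre symbol agrees on `[1, M]` with the completely multiplicative pattern `g` (`g(p) = +1` iff
  `p mod 4096 ∈ (2048, 4096)`): CRT + quadratic reciprocity + Dirichlet (`Nat.forall_exists_prime_gt_and_zmodEq`).
* `ConreyPositivityCert.cert` — ONE compiled interval computation (`native_decide`) on the tree's verified
  fixed-point engine `Literature.Analysis.ValidatedNumerics.FixedPointInterval` (scale `2^48`, `CB.expI`
  boxes of `e^{iθ}`, `θ = 2πk/4096`): `total · M + 2^48 < 0`, `M = 2^17`, `total = -4269241978`
  (`total/2^48 = -1.5167·10⁻⁵ < -1/M = -7.63·10⁻⁶`).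
* `ConreyPositivityCert.tsum_neg_of_imitates` — soundness: if `(n/q) = g(n)` on `[1, M]` then
  `∑_{n ≥ 1} (n/q) sin(2πn/4096)/n² ≤ total/2^48 + 1/M < 0` (head by the certificate, tail
  `≤ ∑_{n>M} n⁻² ≤ 1/M` by `sum_Ioc_inv_sq_le_sub`).
-/

set_option linter.dupNamespace false

namespace Summit.RiemannHypothesis.RiemannHypothesis.Theorems

namespace ConreyPositivityCert

open Literature.Analysis.ValidatedNumerics.Numerics

/-- The sign prescribed at a prime `p`: `+1` on the residue window `p mod 4096 ∈ (2048, 4096)`,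
`-1` elsewhere (in particular `eps 2 = -1 = (2/q)` for `q ≡ 3 (mod 8)`). [folklore] -/
def eps (p : ℕ) : ℤ := if 2048 < p % 4096 then 1 else -1

/-- The completely multiplicative `±1` pattern to be imitated: the product of `eps` over the prime
factors counted with multiplicity. [folklore] -/
def g (n : ℕ) : ℤ := ((Nat.primeFactorsList n).map eps).prod

/-- [folklore] -/
theorem eps_cases (p : ℕ) : eps p = 1 ∨ eps p = -1 := by
  unfold eps; split_ifs <;> simp

/-- [folklore] -/
theorem eps_two : eps 2 = -1 := by decide

/-- A product of signs is a sign. [folklore] -/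
theorem prod_eq_one_or_eq_neg_one (l : List ℤ) (h : ∀ x ∈ l, x = 1 ∨ x = -1) :
    l.prod = 1 ∨ l.prod = -1 := by
  induction l with
  | nil => simp
  | cons a t ih =>
    rw [List.prod_cons]
    have ha := h a (by simp)
    have ht := ih fun x hx => h x (by simp [hx])
    rcases ha with rfl | rfl <;> rcases ht with h1 | h1 <;> simp [h1]

/-- [folklore] -/
theorem g_cases (n : ℕ) : g n = 1 ∨ g n = -1 :=
  prod_eq_one_or_eq_neg_one _ fun x hx => by
    obtain ⟨p, -, rfl⟩ := List.mem_map.mp hx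
    exact eps_cases p

/-- **Primes `q ≡ 3 (mod 8)` with prescribed Legendre symbols `(p/q)` at the odd primes `p ≤ M`.**
Chinese remainder theorem for the moduli `8` and the odd primes `p ≤ M`, Dirichlet's theorem on
primes in arithmetic progressions (`Nat.forall_exists_prime_gt_and_zmodEq`) and quadratic
reciprocity (`q ≡ 3 (mod 4)`). [folklore] -/
theorem exists_prime_jacobiSym_eq_eps (M N : ℕ) :
    ∃ q : ℕ, q.Prime ∧ q % 8 = 3 ∧ N < q ∧
      ∀ p : ℕ, p.Prime → p ≠ 2 → p ≤ M → jacobiSym (p : ℤ) q = eps p := by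
  classical
  set P : Finset ℕ := (Finset.range (M + 1)).filter (fun p => p.Prime ∧ p ≠ 2) with hPdef
  have hPmem : ∀ p ∈ P, p.Prime ∧ p ≠ 2 := fun p hp => (Finset.mem_filter.mp hp).2
  have hPodd : ∀ p ∈ P, Odd p := fun p hp => (hPmem p hp).1.odd_of_ne_two (hPmem p hp).2
  let t : ℕ → ℤ := fun p => if p % 4 = 1 then eps p else -eps p
  have ht : ∀ p, t p = 1 ∨ t p = -1 := fun p => by
    rcases eps_cases p with h | h <;> simp only [t, h] <;> split_ifs <;> simp
  have key : ∀ p ∈ P, ∃ a : ℕ, ¬ p ∣ a ∧ jacobiSym (a : ℤ) p = t p := fun p hp =>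
    Literature.NumberTheory.EllipticCurves.exists_jacobiSym_eq_sign (hPmem p hp).1 (hPmem p hp).2 (ht p)
  choose! a ha hJ using key
  let b : ℕ → ℕ := fun i => if i = 8 then 3 else a i
  have h8 : (8 : ℕ) ∉ P := fun h => by have := Nat.odd_iff.mp (hPodd 8 h); omega
  have hne8 : ∀ p ∈ P, p ≠ 8 := fun p hp h => h8 (h ▸ hp)
  have hs : ∀ i ∈ insert 8 P, id i ≠ 0 := fun i hi => by
    rcases Finset.mem_insert.mp hi with rfl | hi
    exacts [by norm_num, (hPmem i hi).1.ne_zero]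
  have hcop8 : ∀ p ∈ P, Nat.Coprime 8 p := fun p hp => by
    have h2 : Nat.Coprime 2 p := Nat.coprime_two_left.mpr (hPodd p hp)
    simpa using h2.pow_left 3
  have hpp : Set.Pairwise (↑(insert 8 P) : Set ℕ) (Function.onFun Nat.Coprime id) := by
    intro i hi j hj hij
    simp only [Finset.coe_insert, Set.mem_insert_iff, Finset.mem_coe] at hi hj
    rcases hi with rfl | hi <;> rcases hj with rfl | hj
    · exact absurd rfl hij
    · exact hcop8 j hj
    · exact (hcop8 i hi).symm
    · exact (Nat.coprime_primes (hPmem i hi).1 (hPmem j hj).1).mpr hij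
  obtain ⟨c, hc⟩ := Nat.chineseRemainderOfFinset b id (insert 8 P) hs hpp
  have hc8 : c ≡ 3 [MOD 8] := by
    have := hc 8 (Finset.mem_insert_self 8 P)
    simpa [b] using this
  have hcp : ∀ p ∈ P, c ≡ a p [MOD p] := fun p hp => by
    have := hc p (Finset.mem_insert_of_mem hp)
    simpa [b, hne8 p hp] using this
  set m : ℕ := 8 * ∏ p ∈ P, p with hm
  have hm0 : m ≠ 0 :=
    mul_ne_zero (by norm_num) (Finset.prod_ne_zero_iff.mpr fun p hp => (hPmem p hp).1.ne_zero)
  have hcop : Nat.Coprime c m := by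
    refine Nat.Coprime.mul_right ?_ (Nat.Coprime.prod_right fun p hp => ?_)
    · have h2 : Nat.Coprime c 2 := by
        rw [Nat.coprime_two_right, Nat.odd_iff]
        have := hc8
        unfold Nat.ModEq at this
        omega
      simpa using h2.pow_right 3
    · rw [Nat.coprime_comm, Nat.Prime.coprime_iff_not_dvd (hPmem p hp).1]
      exact fun h => ha p hp (((hcp p hp).dvd_iff dvd_rfl).mp h)
  obtain ⟨q, hqN, hq, hqc⟩ := Nat.forall_exists_prime_gt_and_zmodEq N hm0
    (Nat.isCoprime_iff_coprime.mpr hcop)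
  have hqc' : q ≡ c [MOD m] := Int.natCast_modEq_iff.mp hqc
  have hq8 : q % 8 = 3 := (hqc'.of_mul_right _).trans hc8
  have hq4 : q % 4 = 3 := by omega
  have hqodd : Odd q := Nat.odd_iff.mpr (by omega)
  refine ⟨q, hq, hq8, hqN, fun p hp hp2 hpM => ?_⟩
  have hpP : p ∈ P := by
    simp only [hPdef, Finset.mem_filter, Finset.mem_range]
    exact ⟨Nat.lt_succ_of_le hpM, hp, hp2⟩
  have hqa : q ≡ a p [MOD p] :=
    ((hqc'.of_mul_left 8).of_dvd (Finset.dvd_prod_of_mem _ hpP)).trans (hcp p hpP)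
  have hJq : jacobiSym (q : ℤ) p = t p := by
    calc jacobiSym (q : ℤ) p = jacobiSym ((q % p : ℕ) : ℤ) p := by
          rw [jacobiSym.mod_left, Int.natCast_mod]
      _ = jacobiSym ((a p % p : ℕ) : ℤ) p := by rw [hqa]
      _ = jacobiSym (a p : ℤ) p := by rw [Int.natCast_mod, ← jacobiSym.mod_left]
      _ = t p := hJ p hpP
  have hp4 : p % 4 = 1 ∨ p % 4 = 3 := by
    have := Nat.odd_iff.mp (hp.odd_of_ne_two hp2); omega
  rcases hp4 with hp4 | hp4
  · rw [jacobiSym.quadratic_reciprocity_one_mod_four hp4 hqodd, hJq]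
    simp [t, hp4]
  · rw [jacobiSym.quadratic_reciprocity_three_mod_four hp4 hq4, hJq]
    simp [t, hp4]

/-- **Imitating primes.** For every `M`, `N` there is a prime `q ≡ 3 (mod 8)`, `q > N`, whose Legendre
symbol agrees with the pattern `g` on `[1, M]` (`(2/q) = -1 = g(2)` since `q ≡ 3 (mod 8)`; odd primes by
`exists_prime_jacobiSym_eq_eps`; multiplicativity). [folklore] -/
theorem exists_prime_imitating (M N : ℕ) : ∃ q : ℕ, q.Prime ∧ q % 8 = 3 ∧ N < q ∧
    ∀ n : ℕ, 1 ≤ n → n ≤ M → jacobiSym (n : ℤ) q = g n := by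
  obtain ⟨q, hq, hq8, hqN, hJ⟩ := exists_prime_jacobiSym_eq_eps M N
  refine ⟨q, hq, hq8, hqN, fun n hn1 hnM => ?_⟩
  have hn0 : n ≠ 0 := by omega
  have hqodd : Odd q := Nat.odd_iff.mpr (by omega)
  have hprime : ∀ p ∈ n.primeFactorsList, jacobiSym ((p : ℕ) : ℤ) q = eps p := by
    intro p hp
    have hpp : p.Prime := Nat.prime_of_mem_primeFactorsList hp
    have hpM : p ≤ M := (Nat.le_of_mem_primeFactorsList hp).trans hnM
    by_cases hp2 : p = 2
    · subst hp2
      rw [Nat.cast_ofNat, jacobiSym.at_two hqodd, ZMod.χ₈_nat_eq_if_mod_eight, eps_two]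
      have h1 : q % 2 ≠ 0 := by omega
      have h2 : ¬ (q % 8 = 1 ∨ q % 8 = 7) := by omega
      simp [h1, h2]
    · exact hJ p hpp hp2 hpM
  have hcast : (n : ℤ) = (n.primeFactorsList.map (fun p : ℕ => (p : ℤ))).prod := by
    rw [← Nat.cast_list_prod, Nat.prod_primeFactorsList hn0]
  calc jacobiSym (n : ℤ) q
        = ((n.primeFactorsList.map (fun p : ℕ => (p : ℤ))).map (fun a => jacobiSym a q)).prod := by
          rw [hcast]; exact jacobiSym.list_prod_left
    _ = (n.primeFactorsList.map eps).prod := by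
          rw [List.map_map]
          congr 1
          exact List.map_congr_left fun p hp => hprime p hp
    _ = g n := rfl

/-- Truncation point `M = 2^17` of the certificate. [folklore] -/
def M : ℕ := 131072

/-- Enclosure of the angle `θ_k = 2πk/4096`. [folklore] -/
def thetaFI (k : ℕ) : FI := (FI.pi.mulInt (2 * (k : ℤ))).divNat 4096

/-- [folklore] -/
theorem mem_thetaFI (k : ℕ) : FI.mem (2 * Real.pi * k / 4096) (thetaFI k) := by
  have h := FI.mem_divNat (FI.mem_mulInt FI.mem_pi (2 * (k : ℤ))) (n := 4096) (by norm_num)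
  unfold thetaFI
  convert h using 1
  push_cast
  ring

/-- The table of boxes enclosing `e^{iθ_k}`, `k < 4096` (`CB.expI`, evaluated once). [folklore] -/
def expTab : Array (Option CB) := Array.ofFn (n := 4096) fun k => CB.expI (thetaFI k.val)

/-- Upper bound, at scale `2^48`, for `s · sin θ / n²` read off an optional box `B ∋ e^{iθ}`
(`s = ±1`); the fallback value `2^48` (never taken) keeps it sound if an enclosure were missing.
[folklore] -/
def ubOf (o : Option (Option CB)) (s : ℤ) (n : ℕ) : ℤ :=
  match o with
  | some (some B) => ((if s = 1 then B.im else B.im.neg).divNat (n ^ 2)).hi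
  | _ => SC

/-- `ub n = ubOf expTab[n mod 4096]? (g n) n`. [folklore] -/
def ub (n : ℕ) : ℤ := ubOf expTab[n % 4096]? (g n) n

/-- Reading the table. [folklore] -/
theorem expTab_getElem? {k : ℕ} (hk : k < 4096) : expTab[k]? = some (CB.expI (thetaFI k)) := by
  rw [expTab, Array.getElem?_ofFn, dif_pos hk]

/-- The certified total `∑_{1 ≤ n ≤ M} ub n` (an integer, `= -4269241978`). [folklore] -/
def total : ℤ := ∑ n ∈ Finset.range (M + 1), if n = 0 then 0 else ub n

/-- **The certificate** (ONE compiled evaluation, `native_decide`): `total · M + 2^48 < 0`, i.e.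
`total / 2^48 < -1/M`. [folklore] -/
theorem cert : total * (M : ℤ) + (SC : ℤ) < 0 := by
  native_decide

/-- The `n`-th term of the imitated series at `x = 1/4096`. [folklore] -/
noncomputable def term (n : ℕ) : ℝ :=
  (g n : ℝ) * Real.sin (2 * Real.pi * n * (1 / 4096)) / (n : ℝ) ^ 2

/-- `|term n| ≤ 1`. [folklore] -/
theorem abs_term_le_one (n : ℕ) : |term n| ≤ 1 := by
  unfold term
  rw [abs_div, abs_mul]
  have hg : |(g n : ℝ)| = 1 := by rcases g_cases n with h | h <;> simp [h]
  rw [hg, one_mul]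
  rcases Nat.eq_zero_or_pos n with rfl | hn
  · simp
  · have hn' : (1 : ℝ) ≤ n := by exact_mod_cast hn
    have h1 : |Real.sin (2 * Real.pi * n * (1 / 4096))| ≤ 1 := Real.abs_sin_le_one _
    have h2 : (1 : ℝ) ≤ |(n : ℝ) ^ 2| := by rw [abs_of_nonneg (by positivity)]; nlinarith
    rw [div_le_one (by linarith)]; linarith

/-- Periodicity: `sin(2πn/4096) = sin θ_{n mod 4096}`. [folklore] -/
theorem sin_eq_sin_mod (n : ℕ) :
    Real.sin (2 * Real.pi * n * (1 / 4096)) = Real.sin (2 * Real.pi * (n % 4096 : ℕ) / 4096) := by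
  have h := Nat.div_add_mod n 4096
  have hn : (n : ℝ) = 4096 * ((n / 4096 : ℕ) : ℝ) + ((n % 4096 : ℕ) : ℝ) := by exact_mod_cast h.symm
  have : 2 * Real.pi * n * (1 / 4096) =
      2 * Real.pi * (n % 4096 : ℕ) / 4096 + (n / 4096 : ℕ) * (2 * Real.pi) := by
    rw [hn]; ring
  rw [this, Real.sin_add_nat_mul_two_pi]

/-- Soundness of `ub`: `term n · 2^48 ≤ ub n` for `n ≥ 1`. [folklore] -/
theorem term_mul_SC_le_ub {n : ℕ} (hn : 1 ≤ n) : term n * SC ≤ ub n := by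
  have hk : n % 4096 < 4096 := Nat.mod_lt _ (by norm_num)
  have hnpos : 0 < n := hn
  have hsq : 0 < n ^ 2 := by positivity
  rw [ub, expTab_getElem? hk]
  cases hexp : CB.expI (thetaFI (n % 4096)) with
  | none =>
    show term n * SC ≤ ((SC : ℤ) : ℝ)
    have h := abs_term_le_one n
    have hSC := SC_pos
    calc term n * SC ≤ |term n| * SC := by gcongr; exact le_abs_self _
      _ ≤ 1 * SC := by gcongr
      _ = ((SC : ℤ) : ℝ) := by push_cast; ring
  | some B =>
    show term n * SC ≤ ((((if g n = 1 then B.im else B.im.neg).divNat (n ^ 2)).hi : ℤ) : ℝ)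
    have hmem := CB.mem_expI hexp (mem_thetaFI (n % 4096))
    have hsin : FI.mem (Real.sin (2 * Real.pi * n * (1 / 4096))) B.im := by
      have h2 := hmem.2
      rw [Complex.exp_ofReal_mul_I_im] at h2
      rwa [sin_eq_sin_mod]
    rcases g_cases n with hg | hg
    · rw [if_pos hg]
      have h := (FI.mem_divNat hsin hsq).2
      convert h using 1
      unfold term; rw [hg]; push_cast; ring
    · rw [if_neg (by omega)]
      have h := (FI.mem_divNat (FI.mem_neg hsin) hsq).2
      convert h using 1
      unfold term; rw [hg]; push_cast; ring

/-- `(∑_{n ≤ M} term n) · 2^48 ≤ total`. [folklore] -/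
theorem sum_mul_SC_le_total : (∑ n ∈ Finset.range (M + 1), term n) * SC ≤ total := by
  rw [total, Finset.sum_mul]
  push_cast
  refine Finset.sum_le_sum fun n _ => ?_
  rcases Nat.eq_zero_or_pos n with rfl | hn
  · simp [term]
  · rw [if_neg hn.ne']
    exact term_mul_SC_le_ub hn

/-- `(n/q) sin(2πnx)/n² ≤ 1/n²`. [folklore] -/
theorem fq_term_le (q n : ℕ) (x : ℝ) :
    (jacobiSym (n : ℤ) q : ℝ) * Real.sin (2 * Real.pi * n * x) / (n : ℝ) ^ 2 ≤ 1 / (n : ℝ) ^ 2 := by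
  refine (le_abs_self _).trans ?_
  rw [abs_div, abs_mul, abs_pow, Nat.abs_cast]
  refine div_le_div_of_nonneg_right ?_ (by positivity)
  calc |(jacobiSym (n : ℤ) q : ℝ)| * |Real.sin (2 * Real.pi * n * x)| ≤ 1 * 1 :=
        mul_le_mul (Literature.NumberTheory.LFunctions.Conrey2024.abs_jacobiSym_le_one n q)
          (Real.abs_sin_le_one _) (abs_nonneg _) zero_le_one
    _ = 1 := one_mul 1

/-- Tail bound: `∑_{i ≥ 0} 1/(i + K + 1)² ≤ 1/K` for `K ≥ 1` (Mathlib `sum_Ioc_inv_sq_le_sub`).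
[folklore] -/
theorem tsum_tail_le {K : ℕ} (hK : K ≠ 0) :
    ∑' i : ℕ, 1 / ((i + (K + 1) : ℕ) : ℝ) ^ 2 ≤ 1 / (K : ℝ) := by
  apply Real.tsum_le_of_sum_range_le (fun i => by positivity)
  intro L
  have h := sum_Ioc_inv_sq_le_sub (α := ℝ) hK (Nat.le_add_right K L)
  rw [← Finset.Ico_add_one_add_one_eq_Ioc, Finset.sum_Ico_eq_sum_range] at h
  have hL : K + L + 1 - (K + 1) = L := by omega
  rw [hL] at h
  calc ∑ i ∈ Finset.range L, 1 / ((i + (K + 1) : ℕ) : ℝ) ^ 2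
        = ∑ i ∈ Finset.range L, (((K + 1 + i : ℕ) : ℝ) ^ 2)⁻¹ := by
          refine Finset.sum_congr rfl fun i _ => ?_
          rw [one_div, add_comm i]
    _ ≤ (K : ℝ)⁻¹ - ((K + L : ℕ) : ℝ)⁻¹ := h
    _ ≤ 1 / (K : ℝ) := by
          rw [one_div, sub_le_self_iff]; positivity

/-- **The imitated series is negative at `x = 1/4096`**: head `≤ total/2^48` (`sum_mul_SC_le_total`),
tail `≤ 1/M`, and `total · M + 2^48 < 0` (`cert`). [folklore] -/
theorem tsum_neg_of_imitates {q : ℕ}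
    (hJ : ∀ n : ℕ, 1 ≤ n → n ≤ M → jacobiSym (n : ℤ) q = g n) :
    ∑' n : ℕ, (jacobiSym (n : ℤ) q : ℝ) * Real.sin (2 * Real.pi * n * (1 / 4096)) / (n : ℝ) ^ 2 < 0 := by
  set F : ℕ → ℝ := fun n =>
    (jacobiSym (n : ℤ) q : ℝ) * Real.sin (2 * Real.pi * n * (1 / 4096)) / (n : ℝ) ^ 2 with hF
  have hsum : Summable F :=
    Literature.NumberTheory.LFunctions.Conrey2024.summable_fq_term q (1 / 4096)
  have hsplit : ∑' n, F n = (∑ n ∈ Finset.range (M + 1), F n) + ∑' i, F (i + (M + 1)) :=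
    (hsum.sum_add_tsum_nat_add (M + 1)).symm
  have hhead : ∑ n ∈ Finset.range (M + 1), F n = ∑ n ∈ Finset.range (M + 1), term n := by
    refine Finset.sum_congr rfl fun n hn => ?_
    rcases Nat.eq_zero_or_pos n with rfl | hpos
    · simp [hF, term]
    · have hnM : n ≤ M := Nat.lt_succ_iff.mp (Finset.mem_range.mp hn)
      simp only [hF, term, hJ n hpos hnM]
  have hM0 : M ≠ 0 := by norm_num [M]
  have htail : ∑' i, F (i + (M + 1)) ≤ 1 / (M : ℝ) := by
    have hs1 : Summable fun i => F (i + (M + 1)) := (summable_nat_add_iff (M + 1)).mpr hsum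
    have hs2 : Summable fun i : ℕ => 1 / ((i + (M + 1) : ℕ) : ℝ) ^ 2 :=
      (summable_nat_add_iff (f := fun n : ℕ => 1 / (n : ℝ) ^ 2) (M + 1)).mpr
        (Real.summable_one_div_nat_pow.mpr one_lt_two)
    calc ∑' i, F (i + (M + 1)) ≤ ∑' i : ℕ, 1 / ((i + (M + 1) : ℕ) : ℝ) ^ 2 :=
          hs1.tsum_le_tsum (fun i => fq_term_le q _ _) hs2
      _ ≤ 1 / (M : ℝ) := tsum_tail_le hM0
  have hcert : (total : ℝ) * (M : ℝ) + SC < 0 := by exact_mod_cast cert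
  have hheadle : (∑ n ∈ Finset.range (M + 1), term n) * SC ≤ total := sum_mul_SC_le_total
  have hSC : (0 : ℝ) < SC := SC_pos
  have hMpos : (0 : ℝ) < M := by norm_num [M]
  rw [hsplit, hhead]
  have h1 : ∑ n ∈ Finset.range (M + 1), term n ≤ (total : ℝ) / SC := by
    rw [le_div_iff₀ hSC]; exact hheadle
  have h2 : (total : ℝ) / SC + 1 / M < 0 := by
    have : (total : ℝ) / SC + 1 / M = ((total : ℝ) * M + SC) / (SC * M) := by
      field_simp
    rw [this]
    exact div_neg_of_neg_of_pos hcert (mul_pos hSC hMpos)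
  linarith

end ConreyPositivityCert

end Summit.RiemannHypothesis.RiemannHypothesis.Theorems
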